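import Mathlib
import Literature.Analysis.FluidPDE.IsometryInvariance
import Literature.MathematicalPhysics.KineticTheory.DiPernaLionsExpDuhamel
import Summits.NavierStokesRegularity.NavierStokesRegularity.Theorems.PlaneEnergyCeilingPlanarEnergyAPrioriSlabLawDuhamel
import Summits.NavierStokesRegularity.NavierStokesRegularity.Theorems.PlaneEnergyCeilingPlanarEnergyAPrioriSlabLawLimit

/-!
# Route PlaneEnergyCeiling · crux `PlanarEnergyAPriori` — THE SLAB ENERGY LAW IN MILD FORM

Helper file for the crux item stmt-NavierStokesRegularity-16855 (`PlanarEnergyAPriori`, route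
`PlaneEnergyCeiling`): lands the registered stub **`stub_slabLawMild`** (stub 3 of the line
`Cruxes/PlanarEnergyAPriori/Lines/birth.lean`, statement verbatim). For a classical solution of
unforced Navier–Stokes on `ℝ³ × [0,t]` with order-(3,2) decay, every planar energy at time `t` is
bounded by the initial planar ceiling in the same direction plus twice the parabolic
flux-convergence functional:

  `E(t;R,c) ≤ sup_{c'} E(0;R,c') + 2 ∫₀ᵗ (πν(t−s))^{-1/2} · osc_{a,b} |F(s;R,a) − F(s;R,b)| ds`,

`F(s;R,a) = ∫_{R{x₂=a}} (|u|²/2 + p)⟪u, Re₂⟫` the Bernoulli flux. Assembly of the landed pieces: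
the space side `slabLaw_sliceBound_ennreal` (caloric weight `G_{ν(t−s)}(x₂ − c)`, the viscous
terms cancel / are signed away, sharp `L¹` norm of `∂_cG`), the time side `slabLaw_timeIntegration`
and the approximate identity `tendsto_integral_planarEnergy_mul_heatKernel` (`s ↑ t`), the initial
caloric mean bounded by the initial ceiling (`∫ G = 1`), the pressure constant `π₀(s)` dropping out
of the flux differences (`planarFlux`: `∫_{x₂=a} u₂ = 0`), and rotation covariance
(`IsClassicalNSSolutionOn.conj_linearIsometryEquiv`) for a general direction `R`.
Folklore (CKN 1982 §2 with a caloric weight; Evans *PDE* §2.3).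
-/

noncomputable section

-- single-conjunct summit: `Summit.<Summit>.<Problem>` repeats the name by the D-0017 layout
set_option linter.dupNamespace false

namespace Summit.NavierStokesRegularity.NavierStokesRegularity.Theorems.PlanarEnergyAPriori

open MeasureTheory Set Filter Topology Function WithLp Real
open scoped ENNReal RealInnerProductSpace Laplacian
open Literature.Analysis.FluidPDE Literature.Analysis.UnboundedOperators
open Summit.NavierStokesRegularity.NavierStokesRegularity.Theorems.PlaneEnergyCeilingSlabEnergyIdentity
open Summit.NavierStokesRegularity.NavierStokesRegularity.Theorems.PlanarEnergyAPriori.SlabLaw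

/-! ### Small `ℝ≥0∞` tools -/

/-- The planar energy in `ℝ≥0∞` is `ofReal` of the real one when `‖g‖²` is integrable. -/
theorem lintegral_enorm_sq_eq_ofReal {α : Type*} [MeasurableSpace α] {μ : Measure α}
    {F : Type*} [NormedAddCommGroup F] {g : α → F} (hg : Integrable (fun y => ‖g y‖ ^ 2) μ) :
    ∫⁻ y, ‖g y‖ₑ ^ 2 ∂μ = ENNReal.ofReal (∫ y, ‖g y‖ ^ 2 ∂μ) := by
  rw [ofReal_integral_eq_lintegral_ofReal hg (ae_of_all _ fun y => sq_nonneg _)]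
  refine lintegral_congr fun y => ?_
  rw [← ofReal_norm, ENNReal.ofReal_pow (norm_nonneg _)]

/-- **A caloric mean is below the supremum**: for `σ > 0` and any real `g`,
`ofReal (∫ G_σ(c − c₀) g(c) dc) ≤ sup_{c'} ofReal (g c')` (`∫ G_σ = 1`). -/
theorem ofReal_integral_heatKernel_mul_le_iSup {σ : ℝ} (hσ : 0 < σ) (c₀ : ℝ) (g : ℝ → ℝ) :
    ENNReal.ofReal (∫ c, heatKernel σ (c - c₀) * g c) ≤ ⨆ c' : ℝ, ENNReal.ofReal (g c') := by
  have hmeas : Measurable fun c : ℝ => ‖heatKernel σ (c - c₀)‖ₑ :=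
    ((continuous_heatKernel σ).comp (continuous_id.sub continuous_const)).measurable.enorm
  calc ENNReal.ofReal (∫ c, heatKernel σ (c - c₀) * g c)
      ≤ ∫⁻ c, ENNReal.ofReal (heatKernel σ (c - c₀) * g c) := Literature.MathematicalPhysics.KineticTheory.ofReal_integral_le_lintegral _
    _ = ∫⁻ c, ‖heatKernel σ (c - c₀)‖ₑ * ENNReal.ofReal (g c) := by
        refine lintegral_congr fun c => ?_
        rw [ENNReal.ofReal_mul (heatKernel_pos hσ _).le, Real.enorm_eq_ofReal (heatKernel_pos hσ _).le]
    _ ≤ ∫⁻ c, ‖heatKernel σ (c - c₀)‖ₑ * ⨆ c' : ℝ, ENNReal.ofReal (g c') := by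
        refine lintegral_mono fun c => ?_
        gcongr
        exact le_iSup (fun c' => ENNReal.ofReal (g c')) c
    _ = ⨆ c' : ℝ, ENNReal.ofReal (g c') := by
        rw [lintegral_mul_const _ hmeas, lintegral_sub_right_eq_self (fun z : ℝ => ‖heatKernel σ z‖ₑ) c₀,
          lintegral_enorm_heatKernel_real hσ, one_mul]

/-! ### Decay hypotheses in product form -/

/-- `(1+‖x‖)³ v ≤ C₀` gives `v ≤ C₀ (1+‖x‖)⁻³`. -/
theorem le_mul_rpow_neg_three_of_mul_le {x : EuclideanSpace ℝ (Fin 3)} {v C₀ : ℝ} (h : (1 + ‖x‖) ^ 3 * v ≤ C₀) :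
    v ≤ C₀ * (1 + ‖x‖) ^ (-(3 : ℝ)) := by
  have ha : 0 < 1 + ‖x‖ := by positivity
  rw [show (-(3 : ℝ)) = -((3 : ℕ) : ℝ) by norm_num, Real.rpow_neg ha.le, Real.rpow_natCast, ← div_eq_mul_inv,
    le_div_iff₀ (pow_pos ha 3), mul_comm]
  exact h

/-- `(1+‖x‖)² v ≤ C₀` gives `v ≤ C₀ (1+‖x‖)⁻²`. -/
theorem le_mul_rpow_neg_two_of_mul_le {x : EuclideanSpace ℝ (Fin 3)} {v C₀ : ℝ} (h : (1 + ‖x‖) ^ 2 * v ≤ C₀) :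
    v ≤ C₀ * (1 + ‖x‖) ^ (-(2 : ℝ)) := by
  have ha : 0 < 1 + ‖x‖ := by positivity
  rw [show (-(2 : ℝ)) = -((2 : ℕ) : ℝ) by norm_num, Real.rpow_neg ha.le, Real.rpow_natCast, ← div_eq_mul_inv,
    le_div_iff₀ (pow_pos ha 2), mul_comm]
  exact h

/-! ### The mild slab law for the coordinate planes -/

variable {ν t : ℝ} {u : ℝ → EuclideanSpace ℝ (Fin 3) → EuclideanSpace ℝ (Fin 3)} {p : ℝ → EuclideanSpace ℝ (Fin 3) → ℝ}

/-- The pressure constant drops out of the planar Bernoulli flux: for a `C¹` divergence-free slice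
with order-3 decay, `∫_{x₂=a}(|u|²/2 + (p − π))u₂ = ∫_{x₂=a}(|u|²/2 + p)u₂` (`∫_{x₂=a} u₂ = 0`,
landed `integral_plane_apply_two_eq_zero`). -/
theorem planarBernoulliFlux_sub_const {v : EuclideanSpace ℝ (Fin 3) → EuclideanSpace ℝ (Fin 3)} {q : EuclideanSpace ℝ (Fin 3) → ℝ}
    {C : ℝ} (hv : ContDiff ℝ 1 v) (hq : Continuous q) (hdiv : VectorCalculus.IsDivFree v)
    (h0 : ∀ x, ‖v x‖ ≤ C * (1 + ‖x‖) ^ (-(3 : ℝ))) (h1 : ∀ x, ‖fderiv ℝ v x‖ ≤ C * (1 + ‖x‖) ^ (-(3 : ℝ)))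
    (ϖ : ℝ) (k0 : ∀ x, ‖q x - ϖ‖ ≤ C * (1 + ‖x‖) ^ (-(2 : ℝ))) (a : ℝ) :
    ∫ y : EuclideanSpace ℝ (Fin 2), (‖v (toLp 2 ![y 0, y 1, a])‖ ^ 2 / 2 + (q (toLp 2 ![y 0, y 1, a]) - ϖ)) *
        v (toLp 2 ![y 0, y 1, a]) 2 =
      ∫ y : EuclideanSpace ℝ (Fin 2), (‖v (toLp 2 ![y 0, y 1, a])‖ ^ 2 / 2 + q (toLp 2 ![y 0, y 1, a])) *
        v (toLp 2 ![y 0, y 1, a]) 2 := by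
  have hC : 0 ≤ C := nonneg_of_norm_le_rpow h0
  -- integrability of the two fluxes on the plane
  have hI1 : Integrable fun y : EuclideanSpace ℝ (Fin 2) =>
      (‖v (toLp 2 ![y 0, y 1, a])‖ ^ 2 / 2 + (q (toLp 2 ![y 0, y 1, a]) - ϖ)) * v (toLp 2 ![y 0, y 1, a]) 2 := by
    refine integrable_plane_of_norm_le_rpow (g := fun x => (‖v x‖ ^ 2 / 2 + (q x - ϖ)) * v x 2)
      (C := C ^ 3 / 2 + C ^ 2) (by fun_prop) (by norm_num : (2 : ℝ) < 5) (fun x => ?_) a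
    exact norm_bernoulli_mul_le_weight (p := fun x => q x - ϖ) hC (h0 x) (k0 x) 2
  have hI2 : Integrable fun y : EuclideanSpace ℝ (Fin 2) => ϖ * v (toLp 2 ![y 0, y 1, a]) 2 := by
    refine (integrable_plane_of_norm_le_rpow (g := fun x => v x 2) (C := C) (by fun_prop) (by norm_num : (2 : ℝ) < 3)
      (fun x => (norm_apply_le_norm (v x) 2).trans (h0 x)) a).const_mul ϖ
  have hsplit : ∀ y : EuclideanSpace ℝ (Fin 2),
      (‖v (toLp 2 ![y 0, y 1, a])‖ ^ 2 / 2 + q (toLp 2 ![y 0, y 1, a])) * v (toLp 2 ![y 0, y 1, a]) 2 =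
        (‖v (toLp 2 ![y 0, y 1, a])‖ ^ 2 / 2 + (q (toLp 2 ![y 0, y 1, a]) - ϖ)) * v (toLp 2 ![y 0, y 1, a]) 2 +
          ϖ * v (toLp 2 ![y 0, y 1, a]) 2 := fun y => by ring
  simp_rw [hsplit]
  rw [integral_add hI1 hI2, integral_const_mul, integral_plane_apply_two_eq_zero hv hdiv h0 h1 a, mul_zero, add_zero]

/-- **The mild slab law before the limit.** Classical solution on `[0,t]`, order-(3,2) decay with
pressure constant `π₀(s)`, `ν > 0`; for `0 < s₁ < t` and every `c₀`:
`ofReal (∫ G_{ν(t−s₁)}(x₂−c₀)|u(s₁)|²) ≤ sup_{c'} E(0,c') + 2∫₀ᵗ ofReal((√(πν(t−s)))⁻¹)·osc F(s) ds`. -/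
theorem slabLawMild_coord_of_lt (hν : 0 < ν) (ht : 0 < t) (hcl : IsClassicalNSSolutionOn (Icc 0 t) ν 0 u p)
    {C : ℝ} {π₀ : ℝ → ℝ}
    (h0 : ∀ s ∈ Icc 0 t, ∀ x, ‖u s x‖ ≤ C * (1 + ‖x‖) ^ (-(3 : ℝ)))
    (h1 : ∀ s ∈ Icc 0 t, ∀ x, ‖fderiv ℝ (u s) x‖ ≤ C * (1 + ‖x‖) ^ (-(3 : ℝ)))
    (h2 : ∀ s ∈ Icc 0 t, ∀ x, ‖iteratedFDeriv ℝ 2 (u s) x‖ ≤ C * (1 + ‖x‖) ^ (-(3 : ℝ)))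
    (k0 : ∀ s ∈ Icc 0 t, ∀ x, |p s x - π₀ s| ≤ C * (1 + ‖x‖) ^ (-(2 : ℝ)))
    (k1 : ∀ s ∈ Icc 0 t, ∀ x, ‖gradient (p s) x‖ ≤ C * (1 + ‖x‖) ^ (-(2 : ℝ)))
    (c₀ : ℝ) {s₁ : ℝ} (hs₁ : 0 < s₁) (hs₁t : s₁ < t) :
    ENNReal.ofReal (∫ x, heatKernel (ν * (t - s₁)) (x 2 - c₀) * ‖u s₁ x‖ ^ 2) ≤
      (⨆ c' : ℝ, ∫⁻ y : EuclideanSpace ℝ (Fin 2), ‖u 0 (toLp 2 ![y 0, y 1, c'])‖ₑ ^ 2) +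
        2 * ∫⁻ s in Ioo 0 t, ENNReal.ofReal ((Real.sqrt (π * ν * (t - s)))⁻¹) *
          ⨆ (a : ℝ) (b : ℝ), ‖(∫ y : EuclideanSpace ℝ (Fin 2), (‖u s (toLp 2 ![y 0, y 1, a])‖ ^ 2 / 2 +
                p s (toLp 2 ![y 0, y 1, a])) * u s (toLp 2 ![y 0, y 1, a]) 2) -
            ∫ y : EuclideanSpace ℝ (Fin 2), (‖u s (toLp 2 ![y 0, y 1, b])‖ ^ 2 / 2 +
                p s (toLp 2 ![y 0, y 1, b])) * u s (toLp 2 ![y 0, y 1, b]) 2‖ₑ := by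
  have hU : UniqueDiffOn ℝ (Icc 0 t) := uniqueDiffOn_Icc ht
  have hsm := hcl.smooth_velocity
  -- time integration: `Φ(s₁) = Φ(0) + ∫₀^{s₁} I`
  have htime := slabLaw_timeIntegration hν ht hcl h0 h1 h2 k1 c₀ hs₁ hs₁t
  rw [eq_sub_iff_add_eq] at htime
  rw [← htime, add_comm]
  refine (ENNReal.ofReal_add_le).trans (add_le_add ?_ ?_)
  · -- the initial caloric mean is below the initial ceiling
    have hI0 : Integrable fun x => ‖u 0 x‖ ^ 2 :=
      integrable_norm_sq (hcl.contDiff_velocity ⟨le_rfl, ht.le⟩).continuous (h0 0 ⟨le_rfl, ht.le⟩)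
    obtain ⟨K, hB0, -, -⟩ := heatKernel_shift_bounds (mul_pos hν ht) c₀
    rw [integral_weight_mul_eq_integral_mul_integral_plane hI0 (contDiff_heatKernel_shift (ν * t) c₀ (n := 0)).continuous hB0]
    refine (ofReal_integral_heatKernel_mul_le_iSup (mul_pos hν ht) c₀ _).trans ?_
    refine iSup_mono fun c' => le_of_eq ?_
    rw [lintegral_enorm_sq_eq_ofReal]
    exact integrable_plane_of_norm_le_rpow (g := fun x => ‖u 0 x‖ ^ 2)
      ((hcl.contDiff_velocity ⟨le_rfl, ht.le⟩).continuous.norm.pow 2) (by norm_num : (2 : ℝ) < 6)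
      (fun x => by rw [Real.norm_of_nonneg (sq_nonneg _)]; exact norm_sq_le_weight (h0 0 ⟨le_rfl, ht.le⟩ x)) c'
  · -- the time integral of the slice bounds
    refine (Literature.MathematicalPhysics.KineticTheory.ofReal_integral_le_lintegral _).trans ?_
    refine (setLIntegral_mono' (g := fun τ => 2 * (ENNReal.ofReal ((Real.sqrt (π * ν * (t - τ)))⁻¹) *
        ⨆ (a : ℝ) (b : ℝ), ‖(∫ y : EuclideanSpace ℝ (Fin 2), (‖u τ (toLp 2 ![y 0, y 1, a])‖ ^ 2 / 2 +
              p τ (toLp 2 ![y 0, y 1, a])) * u τ (toLp 2 ![y 0, y 1, a]) 2) -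
          ∫ y : EuclideanSpace ℝ (Fin 2), (‖u τ (toLp 2 ![y 0, y 1, b])‖ ^ 2 / 2 +
              p τ (toLp 2 ![y 0, y 1, b])) * u τ (toLp 2 ![y 0, y 1, b]) 2‖ₑ))
      measurableSet_Ioo fun τ hτ => ?_).trans ?_
    rotate_left
    · refine (lintegral_mono_set (Ioo_subset_Ioo_right hs₁t.le)).trans (le_of_eq ?_)
      rw [lintegral_const_mul' _ _ ENNReal.ofNat_ne_top]
    -- the slice bound at time `τ`, for the normalised pressure `p − π₀(τ)`
    have hτ' : τ ∈ Icc 0 t := ⟨hτ.1.le, (hτ.2.trans hs₁t).le⟩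
    have hσ : 0 < ν * (t - τ) := mul_pos hν (by linarith [hτ.2])
    have hu2 : ContDiff ℝ 2 (u τ) := (hcl.contDiff_velocity hτ').of_le (by norm_cast)
    have hp1 : ContDiff ℝ 1 (fun x => p τ x - π₀ τ) :=
      ((hcl.contDiff_pressure hτ').of_le (by exact_mod_cast le_top)).sub contDiff_const
    have k0' : ∀ x, ‖p τ x - π₀ τ‖ ≤ C * (1 + ‖x‖) ^ (-(2 : ℝ)) := fun x => by
      rw [Real.norm_eq_abs]; exact k0 τ hτ' x
    have k1' : ∀ x, ‖fderiv ℝ (fun x => p τ x - π₀ τ) x‖ ≤ C * (1 + ‖x‖) ^ (-(2 : ℝ)) := fun x => by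
      rw [fderiv_sub_const', norm_fderiv_eq_norm_gradient]; exact k1 τ hτ' x
    have hacc : Continuous fun x => ν • Δ (u τ) x - convect (u τ) (u τ) x - gradient (fun x => p τ x - π₀ τ) x := by
      have hc : Continuous fun x => timeDerivWithin (Icc 0 t) u τ x := by
        have h1c : ContinuousOn (uncurry (timeDerivWithin (Icc 0 t) u)) (Icc 0 t ×ˢ univ) :=
          (hsm.timeDerivWithin hU).continuousOn
        exact h1c.comp_continuous (continuous_const.prodMk continuous_id) fun x => ⟨hτ', mem_univ x⟩
      simp_rw [gradient_sub_const]
      exact hc.congr fun x => timeDerivWithin_eq_acc hcl hτ' x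
    have key := slabLaw_sliceBound_ennreal hν.le hσ c₀ hu2 hp1 (hcl.divFree τ hτ') (h0 τ hτ') (h1 τ hτ') (h2 τ hτ')
      k0' k1' hacc
    simp only [gradient_sub_const] at key
    -- the pressure constant drops out of the flux
    have hflux : ∀ a, ∫ y : EuclideanSpace ℝ (Fin 2), (‖u τ (toLp 2 ![y 0, y 1, a])‖ ^ 2 / 2 +
        (p τ (toLp 2 ![y 0, y 1, a]) - π₀ τ)) * u τ (toLp 2 ![y 0, y 1, a]) 2 =
        ∫ y : EuclideanSpace ℝ (Fin 2), (‖u τ (toLp 2 ![y 0, y 1, a])‖ ^ 2 / 2 +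
          p τ (toLp 2 ![y 0, y 1, a])) * u τ (toLp 2 ![y 0, y 1, a]) 2 := fun a =>
      planarBernoulliFlux_sub_const (hu2.of_le one_le_two) (hcl.contDiff_pressure hτ').continuous (hcl.divFree τ hτ')
        (h0 τ hτ') (h1 τ hτ') (π₀ τ) k0' a
    simp_rw [hflux] at key
    rw [show π * ν * (t - τ) = π * (ν * (t - τ)) by ring]
    exact key

/-- **THE MILD SLAB LAW FOR THE COORDINATE PLANES.** Classical solution on `[0,t]` (`ν, t > 0`),
order-(3,2) decay with pressure constant `π₀(s)`; for every offset `c₀`: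
`E(t,c₀) ≤ sup_{c'} E(0,c') + 2∫₀ᵗ ofReal((√(πν(t−s)))⁻¹) · sup_{a,b} ‖F(s,a) − F(s,b)‖ₑ ds`,
`F(s,a) = ∫_{x₂=a}(|u|²/2+p)u₂` (limit `s₁ ↑ t` in `slabLawMild_coord_of_lt`). [folklore] -/
theorem slabLawMild_coord (hν : 0 < ν) (ht : 0 < t) (hcl : IsClassicalNSSolutionOn (Icc 0 t) ν 0 u p)
    {C : ℝ} {π₀ : ℝ → ℝ}
    (h0 : ∀ s ∈ Icc 0 t, ∀ x, ‖u s x‖ ≤ C * (1 + ‖x‖) ^ (-(3 : ℝ)))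
    (h1 : ∀ s ∈ Icc 0 t, ∀ x, ‖fderiv ℝ (u s) x‖ ≤ C * (1 + ‖x‖) ^ (-(3 : ℝ)))
    (h2 : ∀ s ∈ Icc 0 t, ∀ x, ‖iteratedFDeriv ℝ 2 (u s) x‖ ≤ C * (1 + ‖x‖) ^ (-(3 : ℝ)))
    (k0 : ∀ s ∈ Icc 0 t, ∀ x, |p s x - π₀ s| ≤ C * (1 + ‖x‖) ^ (-(2 : ℝ)))
    (k1 : ∀ s ∈ Icc 0 t, ∀ x, ‖gradient (p s) x‖ ≤ C * (1 + ‖x‖) ^ (-(2 : ℝ))) (c₀ : ℝ) :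
    ∫⁻ y : EuclideanSpace ℝ (Fin 2), ‖u t (toLp 2 ![y 0, y 1, c₀])‖ₑ ^ 2 ≤
      (⨆ c' : ℝ, ∫⁻ y : EuclideanSpace ℝ (Fin 2), ‖u 0 (toLp 2 ![y 0, y 1, c'])‖ₑ ^ 2) +
        2 * ∫⁻ s in Ioo 0 t, ENNReal.ofReal ((Real.sqrt (π * ν * (t - s)))⁻¹) *
          ⨆ (a : ℝ) (b : ℝ), ‖(∫ y : EuclideanSpace ℝ (Fin 2), (‖u s (toLp 2 ![y 0, y 1, a])‖ ^ 2 / 2 +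
                p s (toLp 2 ![y 0, y 1, a])) * u s (toLp 2 ![y 0, y 1, a]) 2) -
            ∫ y : EuclideanSpace ℝ (Fin 2), (‖u s (toLp 2 ![y 0, y 1, b])‖ ^ 2 / 2 +
                p s (toLp 2 ![y 0, y 1, b])) * u s (toLp 2 ![y 0, y 1, b]) 2‖ₑ := by
  have htt : t ∈ Icc 0 t := ⟨ht.le, le_rfl⟩
  -- the planar energy at time `t` is the limit of the caloric means
  have hlim := tendsto_integral_planarEnergy_mul_heatKernel hν ht hcl h0 h1 h2 k1 c₀
  have hEt : ∫⁻ y : EuclideanSpace ℝ (Fin 2), ‖u t (toLp 2 ![y 0, y 1, c₀])‖ₑ ^ 2 =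
      ENNReal.ofReal (∫ y : EuclideanSpace ℝ (Fin 2), ‖u t (toLp 2 ![y 0, y 1, c₀])‖ ^ 2) :=
    lintegral_enorm_sq_eq_ofReal (integrable_plane_of_norm_le_rpow (g := fun x => ‖u t x‖ ^ 2)
      ((hcl.contDiff_velocity htt).continuous.norm.pow 2) (by norm_num : (2 : ℝ) < 6)
      (fun x => by rw [Real.norm_of_nonneg (sq_nonneg _)]; exact norm_sq_le_weight (h0 t htt x)) c₀)
  rw [hEt]
  refine le_of_tendsto ((ENNReal.continuous_ofReal.tendsto _).comp hlim) ?_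
  filter_upwards [Ioo_mem_nhdsLT ht] with s₁ hs₁
  -- the caloric mean at time `s₁` is the caloric-weighted energy `Φ(s₁)`
  have hs₁' : s₁ ∈ Icc 0 t := ⟨hs₁.1.le, hs₁.2.le⟩
  have hIs : Integrable fun x => ‖u s₁ x‖ ^ 2 :=
    integrable_norm_sq (hcl.contDiff_velocity hs₁').continuous (h0 s₁ hs₁')
  obtain ⟨K, hB0, -, -⟩ := heatKernel_shift_bounds (mul_pos hν (by linarith [hs₁.2] : (0 : ℝ) < t - s₁)) c₀
  have hΦ : ∫ c : ℝ, (∫ y : EuclideanSpace ℝ (Fin 2), ‖u s₁ (toLp 2 ![y 0, y 1, c])‖ ^ 2) * heatKernel (ν * (t - s₁)) (c - c₀) =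
      ∫ x, heatKernel (ν * (t - s₁)) (x 2 - c₀) * ‖u s₁ x‖ ^ 2 := by
    rw [integral_weight_mul_eq_integral_mul_integral_plane hIs
      (contDiff_heatKernel_shift (ν * (t - s₁)) c₀ (n := 0)).continuous hB0]
    exact integral_congr_ae (ae_of_all _ fun c => mul_comm _ _)
  dsimp only [Function.comp_def]
  rw [hΦ]
  exact slabLawMild_coord_of_lt hν ht hcl h0 h1 h2 k0 k1 c₀ hs₁.1 hs₁.2

/-! ### Every direction: rotation covariance -/

/-- **THE MILD SLAB LAW THROUGH EVERY PLANE.** Classical solution on `[0,t]` (`ν, t > 0`) with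
order-(3,2) decay (pressure constant `π₀(s)`); for every linear isometry `R` and offset `c`:
`E(t;R,c) ≤ sup_{c'} E(0;R,c') + 2∫₀ᵗ ofReal((√(πν(t−s)))⁻¹) · sup_{a,b} ‖F(s;R,a) − F(s;R,b)‖ₑ ds`
with the Bernoulli flux `F(s;R,a) = ∫_{R{x₂=a}} (|u|²/2 + p)⟪u, Re₂⟫` — the coordinate law for the
conjugate solution `(R⁻¹u(·,R·), p(·,R·))` (accepted `IsClassicalNSSolutionOn.conj_linearIsometryEquiv`).
[folklore] -/
theorem slabLawMild_dir (hν : 0 < ν) (ht : 0 < t) (hcl : IsClassicalNSSolutionOn (Icc 0 t) ν 0 u p)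
    {C : ℝ} {π₀ : ℝ → ℝ}
    (h0 : ∀ s ∈ Icc 0 t, ∀ x, ‖u s x‖ ≤ C * (1 + ‖x‖) ^ (-(3 : ℝ)))
    (h1 : ∀ s ∈ Icc 0 t, ∀ x, ‖fderiv ℝ (u s) x‖ ≤ C * (1 + ‖x‖) ^ (-(3 : ℝ)))
    (h2 : ∀ s ∈ Icc 0 t, ∀ x, ‖iteratedFDeriv ℝ 2 (u s) x‖ ≤ C * (1 + ‖x‖) ^ (-(3 : ℝ)))
    (k0 : ∀ s ∈ Icc 0 t, ∀ x, |p s x - π₀ s| ≤ C * (1 + ‖x‖) ^ (-(2 : ℝ)))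
    (k1 : ∀ s ∈ Icc 0 t, ∀ x, ‖gradient (p s) x‖ ≤ C * (1 + ‖x‖) ^ (-(2 : ℝ)))
    (R : EuclideanSpace ℝ (Fin 3) ≃ₗᵢ[ℝ] EuclideanSpace ℝ (Fin 3)) (c : ℝ) :
    ∫⁻ y : EuclideanSpace ℝ (Fin 2), ‖u t (R (toLp 2 ![y 0, y 1, c]))‖ₑ ^ 2 ≤
      (⨆ c' : ℝ, ∫⁻ y : EuclideanSpace ℝ (Fin 2), ‖u 0 (R (toLp 2 ![y 0, y 1, c']))‖ₑ ^ 2) +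
        2 * ∫⁻ s in Ioo 0 t, ENNReal.ofReal ((Real.sqrt (π * ν * (t - s)))⁻¹) *
          ⨆ (a : ℝ) (b : ℝ), ‖(∫ y : EuclideanSpace ℝ (Fin 2), (‖u s (R (toLp 2 ![y 0, y 1, a]))‖ ^ 2 / 2 +
                p s (R (toLp 2 ![y 0, y 1, a]))) * ⟪u s (R (toLp 2 ![y 0, y 1, a])), R (EuclideanSpace.single 2 1)⟫) -
            ∫ y : EuclideanSpace ℝ (Fin 2), (‖u s (R (toLp 2 ![y 0, y 1, b]))‖ ^ 2 / 2 +
                p s (R (toLp 2 ![y 0, y 1, b]))) * ⟪u s (R (toLp 2 ![y 0, y 1, b])), R (EuclideanSpace.single 2 1)⟫‖ₑ := by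
  have hU : UniqueDiffOn ℝ (Icc 0 t) := uniqueDiffOn_Icc ht
  -- the conjugate pair
  set v : ℝ → EuclideanSpace ℝ (Fin 3) → EuclideanSpace ℝ (Fin 3) := fun s x => R.symm (u s (R.symm.symm x)) with hv
  set q : ℝ → EuclideanSpace ℝ (Fin 3) → ℝ := fun s x => p s (R.symm.symm x) with hq
  have hvu : ∀ s x, v s x = R.symm (u s (R x)) := fun s x => by simp [hv]
  have hqp : ∀ s x, q s x = p s (R x) := fun s x => by simp [hq]
  have hcl' : IsClassicalNSSolutionOn (Icc 0 t) ν 0 v q := by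
    have h := hcl.conj_linearIsometryEquiv (R := R.symm) hU
    refine h.congr_force fun s _ x => ?_
    simp
  -- decay of the conjugate pair
  have h0' : ∀ s ∈ Icc 0 t, ∀ x, ‖v s x‖ ≤ C * (1 + ‖x‖) ^ (-(3 : ℝ)) := fun s hs' x => by
    rw [hvu, LinearIsometryEquiv.norm_map]; simpa [LinearIsometryEquiv.norm_map] using h0 s hs' (R x)
  have h1' : ∀ s ∈ Icc 0 t, ∀ x, ‖fderiv ℝ (v s) x‖ ≤ C * (1 + ‖x‖) ^ (-(3 : ℝ)) := fun s hs' x => by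
    have : v s = fun y => R.symm (u s (R.symm.symm y)) := rfl
    rw [this, fderiv_conj_linearIsometryEquiv, ContinuousLinearMap.opNorm_linearIsometryEquiv_comp,
      ContinuousLinearMap.opNorm_comp_linearIsometryEquiv]
    simpa [LinearIsometryEquiv.norm_map] using h1 s hs' (R x)
  have h2' : ∀ s ∈ Icc 0 t, ∀ x, ‖iteratedFDeriv ℝ 2 (v s) x‖ ≤ C * (1 + ‖x‖) ^ (-(3 : ℝ)) := fun s hs' x => by
    have : v s = R.symm ∘ (u s ∘ R.symm.symm) := rfl
    rw [this, LinearIsometryEquiv.norm_iteratedFDeriv_comp_left, LinearIsometryEquiv.norm_iteratedFDeriv_comp_right]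
    simpa [LinearIsometryEquiv.norm_map] using h2 s hs' (R x)
  have k0' : ∀ s ∈ Icc 0 t, ∀ x, |q s x - π₀ s| ≤ C * (1 + ‖x‖) ^ (-(2 : ℝ)) := fun s hs' x => by
    rw [hqp]; simpa [LinearIsometryEquiv.norm_map] using k0 s hs' (R x)
  have k1' : ∀ s ∈ Icc 0 t, ∀ x, ‖gradient (q s) x‖ ≤ C * (1 + ‖x‖) ^ (-(2 : ℝ)) := fun s hs' x => by
    have : q s = fun y => p s (R.symm.symm y) := rfl
    rw [this, gradient_comp_linearIsometryEquiv_symm, LinearIsometryEquiv.norm_map]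
    simpa [LinearIsometryEquiv.norm_map] using k1 s hs' (R x)
  -- the coordinate law for the conjugate pair
  have key := slabLawMild_coord hν ht hcl' h0' h1' h2' k0' k1' c
  -- identify planar energies and fluxes of `(v,q)` with those of `(u,p)` through the planes `R{x₂ = ·}`
  have hv2 : ∀ s x, v s x 2 = ⟪u s (R x), R (EuclideanSpace.single 2 1)⟫ := fun s x => by
    rw [hvu]
    have : (R.symm (u s (R x))) 2 = ⟪R.symm (u s (R x)), EuclideanSpace.single 2 1⟫ := by
      simp [EuclideanSpace.inner_single_right]
    rw [this]
    conv_lhs => rw [← LinearIsometryEquiv.inner_map_map R, LinearIsometryEquiv.apply_symm_apply]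
  have hE : ∀ s a, ∫⁻ y : EuclideanSpace ℝ (Fin 2), ‖v s (toLp 2 ![y 0, y 1, a])‖ₑ ^ 2 =
      ∫⁻ y : EuclideanSpace ℝ (Fin 2), ‖u s (R (toLp 2 ![y 0, y 1, a]))‖ₑ ^ 2 := fun s a =>
    lintegral_congr fun y => by rw [hvu, LinearIsometryEquiv.enorm_map]
  have hF : ∀ s a, ∫ y : EuclideanSpace ℝ (Fin 2), (‖v s (toLp 2 ![y 0, y 1, a])‖ ^ 2 / 2 +
      q s (toLp 2 ![y 0, y 1, a])) * v s (toLp 2 ![y 0, y 1, a]) 2 =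
      ∫ y : EuclideanSpace ℝ (Fin 2), (‖u s (R (toLp 2 ![y 0, y 1, a]))‖ ^ 2 / 2 +
        p s (R (toLp 2 ![y 0, y 1, a]))) * ⟪u s (R (toLp 2 ![y 0, y 1, a])), R (EuclideanSpace.single 2 1)⟫ :=
    fun s a => integral_congr_ae (ae_of_all _ fun y => by
      dsimp only
      rw [hv2, hqp, hvu, LinearIsometryEquiv.norm_map])
  simp_rw [hE, hF] at key
  exact key

/-- **Stub 3 of the line `birth`, `stub_slabLawMild` — THE SLAB ENERGY LAW IN MILD FORM**
(registered stub of stmt-NavierStokesRegularity-16855, statement verbatim): for a classical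
solution on the closed slab `[0,t]` with order-(3,2) decay, every planar energy at time `t` is
bounded by the initial planar ceiling in the same direction plus twice the parabolic
flux-convergence functional `∫₀ᵗ (πν(t−s))^{-1/2} osc F(s;R,·) ds`.
[CaffarelliKohnNirenberg1982, LemarieRieusset2016] -/
theorem stub_slabLawMild : ∀ (ν t : ℝ), 0 < ν → 0 < t → ∀ (u : ℝ → EuclideanSpace ℝ (Fin 3) → EuclideanSpace ℝ (Fin 3)) (p : ℝ → EuclideanSpace ℝ (Fin 3) → ℝ), Literature.Analysis.FluidPDE.IsClassicalNSSolutionOn (Set.Icc 0 t) ν 0 u p → (∃ (C₀ : ℝ) (π₀ : ℝ → ℝ), ∀ s ∈ Set.Icc 0 t, ∀ x : EuclideanSpace ℝ (Fin 3), (1 + ‖x‖) ^ 3 * ‖u s x‖ ≤ C₀ ∧ (1 + ‖x‖) ^ 3 * ‖fderiv ℝ (u s) x‖ ≤ C₀ ∧ (1 + ‖x‖) ^ 3 * ‖iteratedFDeriv ℝ 2 (u s) x‖ ≤ C₀ ∧ (1 + ‖x‖) ^ 2 * |p s x - π₀ s| ≤ C₀ ∧ (1 + ‖x‖) ^ 2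 * ‖gradient (p s) x‖ ≤ C₀) → ∀ (R : EuclideanSpace ℝ (Fin 3) ≃ₗᵢ[ℝ] EuclideanSpace ℝ (Fin 3)) (c : ℝ), ∫⁻ y : EuclideanSpace ℝ (Fin 2), ‖u t (R (WithLp.toLp 2 ![y 0, y 1, c]))‖ₑ ^ 2 ≤ (⨆ c' : ℝ, ∫⁻ y : EuclideanSpace ℝ (Fin 2), ‖u 0 (R (WithLp.toLp 2 ![y 0, y 1, c']))‖ₑ ^ 2) + 2 * (∫⁻ s in Set.Ioo 0 t, ENNReal.ofReal ((Real.sqrt (Real.pi * ν * (t - s)))⁻¹) * (⨆ (a : ℝ) (b : ℝ), ‖(∫ y : EuclideanSpace ℝ (Fin 2), (‖u s (R (WithLp.toLp 2 ![y 0, y 1, a]))‖ ^ 2 / 2 + p s (R (WithLp.toLp 2 ![y 0, y 1, a]))) * inner ℝ (u s (R (WithLp.toLp 2 ![y 0, y 1, a]))) (R (EuclideanSpace.single 2 1))) - (∫ y : EuclideanSpace ℝ (Fin 2), (‖u s (R (WithLp.toLp 2 ![y 0, y 1, b]))‖ ^ 2 / 2 + p s (R (WithLp.toLp 2 ![y 0,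 y 1, b]))) * inner ℝ (u s (R (WithLp.toLp 2 ![y 0, y 1, b]))) (R (EuclideanSpace.single 2 1)))‖ₑ)) :=
  fun _ _ hν ht _ _ hcl hdec R c => by
    obtain ⟨C₀, π₀, hdec⟩ := hdec
    exact slabLawMild_dir hν ht hcl
      (fun s hs x => le_mul_rpow_neg_three_of_mul_le (hdec s hs x).1)
      (fun s hs x => le_mul_rpow_neg_three_of_mul_le (hdec s hs x).2.1)
      (fun s hs x => le_mul_rpow_neg_three_of_mul_le (hdec s hs x).2.2.1)
      (fun s hs x => le_mul_rpow_neg_two_of_mul_le (hdec s hs x).2.2.2.1)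
      (fun s hs x => le_mul_rpow_neg_two_of_mul_le (hdec s hs x).2.2.2.2) R c

end Summit.NavierStokesRegularity.NavierStokesRegularity.Theorems.PlanarEnergyAPriori

end
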